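import Mathlib.Analysis.Fourier.AddCircleMulti
import Mathlib.Analysis.SpecialFunctions.Trigonometric.Bounds
import Literature.Analysis.FunctionSpaces.TorusMollifierEstimates
import Literature.Analysis.FunctionSpaces.TorusCalculusProofs
import Literature.Analysis.FunctionSpaces.TorusFourierCalculus
import HarnessLib

/-!
# The periodic squared-sine distance on the torus

Analysis/FunctionSpaces support file (everything proved). The smooth `1`-periodic substitute
for the squared distance to the origin on `T^d = (ℝ/ℤ)^d`,

  `S(z) = ∑ᵢ sin²(π zᵢ) = ∑ᵢ (1 - cos(2π zᵢ))/2`   (`Torus.sinSqSum`),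

together with its coordinate trigonometric functions `cos(2π zᵢ)`, `sin(2π zᵢ)` (`Torus.cosCoord`,
`Torus.sinCoord`), their smoothness, partial derivatives (`∂ⱼ S = π sin(2π zⱼ)`,
`∂ⱼ sin(2π zⱼ) = 2π cos(2π zⱼ)`), parity, and the two-sided comparison with the flat (sup-norm)
distance `‖z‖ = maxᵢ ‖zᵢ‖` of `T^d`:

  `4 ‖z‖² ≤ S(z) ≤ π² d ‖z‖²`,  `∑ⱼ (∂ⱼ S)² ≤ 4π² S`.

(Jordan's inequality `sin(πt) ≥ 2t` on `[0, ½]` and `|sin x| ≤ |x|`.) This is the kernel of the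
smooth logarithmic transport cost `log(1 + S/δ²)` of the two-point (Crippa–De Lellis type)
dissipation estimates (`FluidPDE/PeriodicLogCost`).

## References

* G. Crippa, C. De Lellis, *Estimates and regularity results for the DiPerna–Lions flow*,
  J. reine angew. Math. 616 (2008), 15–46, §2 (the functional `log(1 + |·|/δ)`). [`CrippaDeLellis2008`]
* L. Grafakos, *Classical Fourier Analysis*, 3rd ed. (2014), §3.1.1 (characters of `T^d`). [`Grafakos2014`]
-/

noncomputable section

open MeasureTheory Set Filter Topology Function Real
open scoped InnerProductSpace ContDiff

namespace Literature.Analysis.FunctionSpaces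

namespace Torus

variable {d : Type*} [Fintype d]

/-! ## Coordinate cosines and sines -/

/-- `cos(2π zᵢ)`, the real part of the first character in the `i`-th coordinate. [folklore] -/
def cosCoord (i : d) (z : UnitAddTorus d) : ℝ := ((fourier 1 (z i) : ℂ)).re

/-- `sin(2π zᵢ)`, the imaginary part of the first character in the `i`-th coordinate. [folklore] -/
def sinCoord (i : d) (z : UnitAddTorus d) : ℝ := ((fourier 1 (z i) : ℂ)).im

/-- The periodic squared-sine distance `S(z) = ∑ᵢ (1 - cos(2π zᵢ))/2 = ∑ᵢ sin²(π zᵢ)`. [folklore] -/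
def sinSqSum (z : UnitAddTorus d) : ℝ := ∑ i, (1 - cosCoord i z) / 2

omit [Fintype d] in
/-- The first character at a real representative: `e₁(x) = exp(2πi x)`. [folklore] -/
theorem fourier_one_coe (x : ℝ) : (fourier 1 ((x : ℝ) : UnitAddCircle) : ℂ) = Complex.exp ((2 * π * x : ℝ) * Complex.I) := by
  rw [fourier_coe_apply]
  congr 1
  push_cast
  ring

omit [Fintype d] in
/-- `cos(2π zᵢ)` at a real representative. [folklore] -/
theorem cosCoord_of_eq {i : d} {z : UnitAddTorus d} {x : ℝ} (h : z i = (x : UnitAddCircle)) :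
    cosCoord i z = Real.cos (2 * π * x) := by
  rw [cosCoord, h, fourier_one_coe, Complex.exp_ofReal_mul_I_re]

omit [Fintype d] in
/-- `sin(2π zᵢ)` at a real representative. [folklore] -/
theorem sinCoord_of_eq {i : d} {z : UnitAddTorus d} {x : ℝ} (h : z i = (x : UnitAddCircle)) :
    sinCoord i z = Real.sin (2 * π * x) := by
  rw [sinCoord, h, fourier_one_coe, Complex.exp_ofReal_mul_I_im]

omit [Fintype d] in
/-- Every point of the circle has a real representative. [folklore] -/
theorem exists_coe_eq (a : UnitAddCircle) : ∃ x : ℝ, (x : UnitAddCircle) = a := Quotient.exists_rep a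

omit [Fintype d] in
/-- `|cos(2π zᵢ)| ≤ 1`. [folklore] -/
theorem abs_cosCoord_le (i : d) (z : UnitAddTorus d) : |cosCoord i z| ≤ 1 := by
  obtain ⟨x, hx⟩ := exists_coe_eq (z i)
  rw [cosCoord_of_eq hx.symm]
  exact abs_cos_le_one _

omit [Fintype d] in
/-- `cos(2π zᵢ) ≤ 1`. [folklore] -/
theorem cosCoord_le_one (i : d) (z : UnitAddTorus d) : cosCoord i z ≤ 1 := (abs_le.1 (abs_cosCoord_le i z)).2

omit [Fintype d] in
/-- `(1 - cos(2π x))/2 = sin²(π x)`. [folklore] -/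
theorem one_sub_cos_div_two (x : ℝ) : (1 - Real.cos (2 * π * x)) / 2 = Real.sin (π * x) ^ 2 := by
  rw [Real.sin_sq_eq_half_sub]; ring_nf

/-- `S(z) = ∑ᵢ sin²(π xᵢ)` for real representatives `xᵢ` of the coordinates. [folklore] -/
theorem sinSqSum_of_eq {z : UnitAddTorus d} {x : d → ℝ} (h : ∀ i, z i = (x i : UnitAddCircle)) :
    sinSqSum z = ∑ i, Real.sin (π * x i) ^ 2 := by
  unfold sinSqSum
  exact Finset.sum_congr rfl fun i _ => by rw [cosCoord_of_eq (h i), one_sub_cos_div_two]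

/-- `S ≥ 0`. [folklore] -/
theorem sinSqSum_nonneg (z : UnitAddTorus d) : 0 ≤ sinSqSum z :=
  Finset.sum_nonneg fun i _ => by linarith [cosCoord_le_one i z]

/-- `S ≤ d`. [folklore] -/
theorem sinSqSum_le_card (z : UnitAddTorus d) : sinSqSum z ≤ Fintype.card d := by
  unfold sinSqSum
  calc ∑ i, (1 - cosCoord i z) / 2 ≤ ∑ _i : d, (1 : ℝ) :=
        Finset.sum_le_sum fun i _ => by linarith [(abs_le.1 (abs_cosCoord_le i z)).1]
    _ = Fintype.card d := by simp

/-! ## Parity -/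

omit [Fintype d] in
/-- `cos(2π zᵢ)` is even. [folklore] -/
theorem cosCoord_neg (i : d) (z : UnitAddTorus d) : cosCoord i (-z) = cosCoord i z := by
  obtain ⟨x, hx⟩ := exists_coe_eq (z i)
  have hneg : (-z) i = ((-x : ℝ) : UnitAddCircle) := by rw [Pi.neg_apply, ← hx]; norm_cast
  rw [cosCoord_of_eq hneg, cosCoord_of_eq hx.symm, mul_neg, Real.cos_neg]

omit [Fintype d] in
/-- `sin(2π zᵢ)` is odd. [folklore] -/
theorem sinCoord_neg (i : d) (z : UnitAddTorus d) : sinCoord i (-z) = -sinCoord i z := by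
  obtain ⟨x, hx⟩ := exists_coe_eq (z i)
  have hneg : (-z) i = ((-x : ℝ) : UnitAddCircle) := by rw [Pi.neg_apply, ← hx]; norm_cast
  rw [sinCoord_of_eq hneg, sinCoord_of_eq hx.symm, mul_neg, Real.sin_neg]

/-- `S` is even. [folklore] -/
theorem sinSqSum_neg (z : UnitAddTorus d) : sinSqSum (-z) = sinSqSum z := by
  unfold sinSqSum; simp_rw [cosCoord_neg]

/-- `S(0) = 0`. [folklore] -/
theorem sinSqSum_zero : sinSqSum (0 : UnitAddTorus d) = 0 := by
  rw [sinSqSum_of_eq (x := fun _ => 0) (fun i => by simp)]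
  simp

/-! ## Comparison with the flat distance -/

omit [Fintype d] in
/-- A real representative realising the norm: `zᵢ = ↑t` with `‖zᵢ‖ = |t| ≤ ½`. [folklore] -/
theorem exists_coe_eq_norm_eq (a : UnitAddCircle) : ∃ t : ℝ, (t : UnitAddCircle) = a ∧ ‖a‖ = |t| ∧ |t| ≤ 1 / 2 := by
  obtain ⟨x, rfl⟩ := exists_coe_eq a
  refine ⟨x - round x, ?_, ?_, abs_sub_round x⟩
  · rw [AddCircle.coe_sub]
    have : ((round x : ℝ) : UnitAddCircle) = 0 := by
      rw [AddCircle.coe_eq_zero_iff]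
      exact ⟨round x, by simp⟩
    rw [this, sub_zero]
  · simpa using AddCircle.norm_eq (p := (1 : ℝ)) (x := x)

omit [Fintype d] in
/-- Jordan's inequality in the form `4 t² ≤ sin²(π t)` for `|t| ≤ ½`. [folklore] -/
theorem four_mul_sq_le_sin_sq {t : ℝ} (ht : |t| ≤ 1 / 2) : 4 * t ^ 2 ≤ Real.sin (π * t) ^ 2 := by
  have key : ∀ s : ℝ, 0 ≤ s → s ≤ 1 / 2 → 2 * s ≤ Real.sin (π * s) := by
    intro s hs0 hs1
    have h := Real.mul_le_sin (x := π * s) (by positivity)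
      (by nlinarith [Real.pi_pos])
    have e : 2 / π * (π * s) = 2 * s := by field_simp
    linarith [e ▸ h]
  rcases le_or_gt 0 t with h0 | h0
  · have h1 := key t h0 ((le_abs_self t).trans ht)
    nlinarith
  · have h1 := key (-t) (by linarith) ((neg_le_abs t).trans ht)
    simp only [mul_neg, Real.sin_neg] at h1
    nlinarith

/-- **Lower comparison**: `4 ‖zᵢ‖² ≤ S(z)` for every coordinate. [folklore] -/
theorem four_mul_norm_apply_sq_le_sinSqSum (z : UnitAddTorus d) (i : d) : 4 * ‖z i‖ ^ 2 ≤ sinSqSum z := by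
  classical
  choose x hx hnorm hle using fun j => exists_coe_eq_norm_eq (z j)
  rw [sinSqSum_of_eq (fun j => (hx j).symm), hnorm i, sq_abs]
  calc 4 * x i ^ 2 ≤ Real.sin (π * x i) ^ 2 := four_mul_sq_le_sin_sq (hle i)
    _ ≤ ∑ j, Real.sin (π * x j) ^ 2 :=
        Finset.single_le_sum (f := fun j => Real.sin (π * x j) ^ 2) (fun j _ => sq_nonneg _) (Finset.mem_univ i)

/-- **Lower comparison with the sup distance**: `4 ‖z‖² ≤ S(z)`, i.e. `‖z‖ ≤ √S(z) / 2`. [folklore] -/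
theorem norm_le_sqrt_sinSqSum_div_two (z : UnitAddTorus d) : ‖z‖ ≤ Real.sqrt (sinSqSum z) / 2 := by
  refine (pi_norm_le_iff_of_nonneg (by positivity)).2 fun i => ?_
  have h := four_mul_norm_apply_sq_le_sinSqSum z i
  have h2 : (2 * ‖z i‖) ^ 2 ≤ sinSqSum z := by nlinarith
  have h3 : 2 * ‖z i‖ ≤ Real.sqrt (sinSqSum z) := Real.le_sqrt_of_sq_le h2
  linarith

/-- `4 ‖z‖² ≤ S(z)`. [folklore] -/
theorem four_mul_norm_sq_le_sinSqSum (z : UnitAddTorus d) : 4 * ‖z‖ ^ 2 ≤ sinSqSum z := by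
  have h := norm_le_sqrt_sinSqSum_div_two z
  have h0 : 0 ≤ ‖z‖ := norm_nonneg _
  have h1 : (2 * ‖z‖) ^ 2 ≤ Real.sqrt (sinSqSum z) ^ 2 := by
    apply pow_le_pow_left₀ (by positivity); linarith
  rw [Real.sq_sqrt (sinSqSum_nonneg z)] at h1
  nlinarith

/-- **Upper comparison**: `S(z) ≤ π² ∑ᵢ ‖zᵢ‖² ≤ π² d ‖z‖²`. [folklore] -/
theorem sinSqSum_le_pi_sq_mul_card_mul_norm_sq (z : UnitAddTorus d) :
    sinSqSum z ≤ π ^ 2 * Fintype.card d * ‖z‖ ^ 2 := by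
  classical
  choose x hx hnorm hle using fun j => exists_coe_eq_norm_eq (z j)
  rw [sinSqSum_of_eq (fun j => (hx j).symm)]
  calc ∑ j, Real.sin (π * x j) ^ 2 ≤ ∑ j, (π * ‖z j‖) ^ 2 := by
        refine Finset.sum_le_sum fun j _ => ?_
        rw [hnorm j]
        calc Real.sin (π * x j) ^ 2 = |Real.sin (π * x j)| ^ 2 := (sq_abs _).symm
          _ ≤ |π * x j| ^ 2 := pow_le_pow_left₀ (abs_nonneg _) (Real.abs_sin_le_abs) 2
          _ = (π * |x j|) ^ 2 := by rw [abs_mul, abs_of_pos Real.pi_pos]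
    _ ≤ ∑ _j : d, (π * ‖z‖) ^ 2 := by
        refine Finset.sum_le_sum fun j _ => ?_
        exact pow_le_pow_left₀ (by positivity) (mul_le_mul_of_nonneg_left (norm_le_pi_norm z j) Real.pi_pos.le) 2
    _ = π ^ 2 * Fintype.card d * ‖z‖ ^ 2 := by
        simp [Finset.sum_const, Finset.card_univ]; ring

/-- `(π sin(2π x))² ≤ 4π² sin²(π x)` (double angle). [folklore] -/
theorem sq_pi_mul_sin_le (x : ℝ) : (π * Real.sin (2 * π * x)) ^ 2 ≤ 4 * π ^ 2 * Real.sin (π * x) ^ 2 := by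
  have h : Real.sin (2 * π * x) = 2 * Real.sin (π * x) * Real.cos (π * x) := by
    rw [show 2 * π * x = 2 * (π * x) by ring, Real.sin_two_mul]
  rw [h]
  nlinarith [Real.cos_sq_le_one (π * x), sq_nonneg (Real.sin (π * x)), sq_nonneg (Real.cos (π * x)),
    Real.pi_pos, mul_nonneg (sq_nonneg (Real.sin (π * x))) (sq_nonneg π)]

/-- **Gradient comparison**: `∑ⱼ (π sin(2π zⱼ))² ≤ 4π² S(z)`. [folklore] -/
theorem sum_sq_pi_mul_sinCoord_le (z : UnitAddTorus d) :
    ∑ j, (π * sinCoord j z) ^ 2 ≤ 4 * π ^ 2 * sinSqSum z := by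
  classical
  choose x hx using fun j => exists_coe_eq (z j)
  rw [sinSqSum_of_eq (fun j => (hx j).symm), Finset.mul_sum]
  refine Finset.sum_le_sum fun j _ => ?_
  rw [sinCoord_of_eq (hx j).symm]
  exact sq_pi_mul_sin_le (x j)

/-! ## Smoothness -/

omit [Fintype d] in
/-- Coordinates of `proj (y)` are the classes of the coordinates of `y`. [folklore] -/
theorem proj_apply' [Fintype d] (y : EuclideanSpace ℝ d) (i : d) : proj y i = ((y i : ℝ) : UnitAddCircle) := rfl

/-- The lift of `cos(2π zᵢ)` is `y ↦ cos(2π yᵢ)`. [folklore] -/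
theorem lift_cosCoord (i : d) : lift (cosCoord i) = fun y : EuclideanSpace ℝ d => Real.cos (2 * π * y i) := by
  funext y
  rw [lift_apply, cosCoord_of_eq (proj_apply' y i)]

/-- The lift of `sin(2π zᵢ)` is `y ↦ sin(2π yᵢ)`. [folklore] -/
theorem lift_sinCoord (i : d) : lift (sinCoord i) = fun y : EuclideanSpace ℝ d => Real.sin (2 * π * y i) := by
  funext y
  rw [lift_apply, sinCoord_of_eq (proj_apply' y i)]

/-- The coordinate maps of `ℝ^d` are smooth. [folklore] -/
theorem contDiff_euclidean_apply (i : d) : ContDiff ℝ ∞ (fun y : EuclideanSpace ℝ d => (y i : ℝ)) :=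
  (EuclideanSpace.proj (𝕜 := ℝ) i).contDiff

/-- `cos(2π zᵢ)` is smooth on the torus. [folklore] -/
theorem isSmooth_cosCoord (i : d) : IsSmooth (cosCoord i : UnitAddTorus d → ℝ) := by
  rw [IsSmooth, lift_cosCoord]
  exact Real.contDiff_cos.comp (contDiff_const.mul (contDiff_euclidean_apply i))

/-- `sin(2π zᵢ)` is smooth on the torus. [folklore] -/
theorem isSmooth_sinCoord (i : d) : IsSmooth (sinCoord i : UnitAddTorus d → ℝ) := by
  rw [IsSmooth, lift_sinCoord]
  exact Real.contDiff_sin.comp (contDiff_const.mul (contDiff_euclidean_apply i))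

/-- `S` is smooth on the torus. [folklore] -/
theorem isSmooth_sinSqSum : IsSmooth (sinSqSum : UnitAddTorus d → ℝ) := by
  have h : (sinSqSum : UnitAddTorus d → ℝ) = fun z => ∑ i, (1 - cosCoord i z) / 2 := rfl
  rw [h, IsSmooth]
  have e : lift (fun z : UnitAddTorus d => ∑ i, (1 - cosCoord i z) / 2) =
      fun y => ∑ i, (1 - lift (cosCoord i) y) / 2 := by funext y; simp [lift_apply]
  rw [e]
  exact ContDiff.sum fun i _ => (contDiff_const.sub (isSmooth_cosCoord i)).div_const _

/-! ## The smooth logarithmic cost -/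

/-- **The smooth periodic logarithmic transport cost** at scale `δ`:
`Φ_δ(z) = log(1 + S(z)/δ²)`, `S(z) = ∑ᵢ sin²(π zᵢ)` — a smooth function on `T^d` comparable to
`log(1 + dist(z,0)²/δ²)` (Crippa–De Lellis 2008, §2, the cost `log(1 + |x - y|/δ)` of the
quantitative stability estimates for Lagrangian flows, in squared periodic form). [folklore] -/
def sinLogCost (δ : ℝ) (z : UnitAddTorus d) : ℝ := Real.log (1 + sinSqSum z / δ ^ 2)

/-- `1 + S/δ² > 0`. [folklore] -/
theorem one_add_sinSqSum_div_pos {δ : ℝ} (z : UnitAddTorus d) : 0 < 1 + sinSqSum z / δ ^ 2 := by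
  have := div_nonneg (sinSqSum_nonneg z) (sq_nonneg δ); linarith

/-- `Φ_δ ≥ 0`. [folklore] -/
theorem sinLogCost_nonneg (δ : ℝ) (z : UnitAddTorus d) : 0 ≤ sinLogCost δ z :=
  Real.log_nonneg (by have := div_nonneg (sinSqSum_nonneg z) (sq_nonneg δ); linarith)

/-- `Φ_δ(0) = 0`. [folklore] -/
theorem sinLogCost_zero (δ : ℝ) : sinLogCost δ (0 : UnitAddTorus d) = 0 := by
  rw [sinLogCost, sinSqSum_zero, zero_div, add_zero, Real.log_one]

/-- `Φ_δ` is even. [folklore] -/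
theorem sinLogCost_neg (δ : ℝ) (z : UnitAddTorus d) : sinLogCost δ (-z) = sinLogCost δ z := by
  rw [sinLogCost, sinLogCost, sinSqSum_neg]

/-- `Φ_δ` is smooth on the torus. [folklore] -/
theorem isSmooth_sinLogCost (δ : ℝ) : IsSmooth (sinLogCost δ : UnitAddTorus d → ℝ) := by
  have e : lift (sinLogCost δ : UnitAddTorus d → ℝ) = fun y => Real.log (1 + lift sinSqSum y / δ ^ 2) := by
    funext y; simp [lift_apply, sinLogCost]
  rw [IsSmooth, e]
  exact (contDiff_const.add (isSmooth_sinSqSum.div_const _)).log fun y => (one_add_sinSqSum_div_pos (proj y)).ne'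

/-- `Φ_δ` is continuous. [folklore] -/
theorem continuous_sinLogCost (δ : ℝ) : Continuous (sinLogCost δ : UnitAddTorus d → ℝ) := (isSmooth_sinLogCost δ).continuous

/-- `Φ_δ` is monotone in `S`: on `{‖z‖ ≥ ℓ}` one has `Φ_δ(z) ≥ log(1 + 4ℓ²/δ²)`. [folklore] -/
theorem log_le_sinLogCost_of_le_norm {δ ℓ : ℝ} (hℓ : 0 ≤ ℓ) {z : UnitAddTorus d} (hz : ℓ ≤ ‖z‖) :
    Real.log (1 + 4 * ℓ ^ 2 / δ ^ 2) ≤ sinLogCost δ z := by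
  have h1 : 4 * ℓ ^ 2 ≤ sinSqSum z :=
    (mul_le_mul_of_nonneg_left (pow_le_pow_left₀ hℓ hz 2) (by norm_num)).trans (four_mul_norm_sq_le_sinSqSum z)
  refine Real.log_le_log (by positivity) ?_
  have := div_le_div_of_nonneg_right h1 (sq_nonneg δ)
  linarith

/-- Near the origin `Φ_δ` is small: `Φ_δ(z) ≤ log(1 + π² d ‖z‖²/δ²)`. [folklore] -/
theorem sinLogCost_le_log (δ : ℝ) (z : UnitAddTorus d) :
    sinLogCost δ z ≤ Real.log (1 + π ^ 2 * Fintype.card d * ‖z‖ ^ 2 / δ ^ 2) := by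
  refine Real.log_le_log (one_add_sinSqSum_div_pos z) ?_
  have := div_le_div_of_nonneg_right (sinSqSum_le_pi_sq_mul_card_mul_norm_sq z) (sq_nonneg δ)
  linarith

/-- The crude bound `Φ_δ ≤ log(1 + d/δ²)`. [folklore] -/
theorem sinLogCost_le_log_card (δ : ℝ) (z : UnitAddTorus d) :
    sinLogCost δ z ≤ Real.log (1 + Fintype.card d / δ ^ 2) := by
  refine Real.log_le_log (one_add_sinSqSum_div_pos z) ?_
  have := div_le_div_of_nonneg_right (sinSqSum_le_card z) (sq_nonneg δ)
  linarith

end Torus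

end Literature.Analysis.FunctionSpaces
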